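import Literature.NumberTheory.EllipticCurves.BinaryQuarticTwoCoveringsInjective
import HarnessLib

/-!
# Two-coverings attached to binary quartic forms, VII: the bootstrap form, `E[2]` and its sign
# characters, and the algebra of the twisted fixed point

Topic `Literature/NumberTheory/EllipticCurves`. Seventh file of the theory proving the named fact
`Literature.NumberTheory.EllipticCurves.bhargavaShankar_card_selmerTwo_eq_kEquivClassCount`
(`BinaryQuarticMinimisation.lean`; Bhargava–Shankar 2015, held arXiv text §5.1, Lemma 5.2). First
file of the **surjectivity** half (every `2`-Selmer class is the class of a locally soluble binary
quartic form — Birch–Swinnerton-Dyer 1963, Lemma 1; Cremona 2001, §5: "when `K` is a number field,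
then all `2`-coverings which are everywhere locally soluble are representable by quartics").

Tools set up here:

* `§1` the **bootstrap form** `f₀ = normRep(4x³y + 4Axy³ + 4By⁴)` (the identity class; invariants
  `−3A·2⁴`, `−27B·2⁶`, i.e. `t = 2`; tree: `invariants_identityQuartic`), which is `ℚ`-soluble with
  the *rational* root `r₀ = −1/k` (`k` the shear), so that its cocycle at `r₀` vanishes and its
  torsor differences `T(r₀, r_k)` enumerate `E_{A,B}[2]` with the *untwisted* Galois action
  (`§2`: `bootData`, `bootData_zero`, `apply_bootData_zero`; the enumeration of `E[2]` itself is
  `exists_eq_torsorPt` / `torsorPt_zero_injective` of file VI, packaged in the next file);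
* `§3` the Klein-group law on the indices (`v4add`) with `T_{k ⊕ l} = T_k + T_l`, and the **sign
  characters** `sgn k i ∈ {±1}` (`= e₂(T_k, T_i)`, the Weil pairing; `sgn_v4add`);
* `§4` the functions `gᵢ(P) = ((x − eᵢ)² − (eᵢ − eⱼ)(eᵢ − e_k))/(2y)` with `gᵢ(P)² = x(2P) − eᵢ`
  and `gᵢ(P + T_j) = sgn j i · gᵢ(P)` (Cremona 2001 / Cassels LEC §14–15: `x − eᵢ ≡ gᵢ²`, the
  `2`-descent map), as identities in the coordinates;
* `§5` the **twisted fixed point identity**: if `zᵢ² = α + βeᵢ` (`β ≠ 0`) then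
  `x' = −α/β − (z₁z₂ + z₁z₃ + z₂z₃)/β` satisfies `x″(x′ − e₁) = e₁x′ + 2e₁² + A` for the sign change
  `(z₁, −z₂, −z₃)` — i.e. `x(R′ + T₁) = M_{T₁}(x(R′))` for the half point `R′` of `(x₀, ·)`,
  `x₀ = −α/β` (the rational point on the conic gives a point of the twisted `ℙ¹`).

## References

* J. E. Cremona, *Classical invariants and 2-descent on elliptic curves*, J. Symbolic Comput. 31
  (2001), §5. [Cremona2001]
* B. J. Birch, H. P. F. Swinnerton-Dyer, *Notes on elliptic curves. I*, J. reine angew. Math. 212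
  (1963), Lemma 1. [BirchSwinnertonDyer1963]
* M. Bhargava, A. Shankar, Ann. of Math. (2) 181 (2015), §5.1 of arXiv:1006.1002v2, Lemma 5.2.
  [BhargavaShankarAnnals2015]
-/

noncomputable section

open scoped Classical

universe u

namespace Literature.NumberTheory.EllipticCurves

namespace TwoCovering

open BinaryQuartic WeierstrassCurve WeierstrassCurve.Affine GaloisRepresentations

/-! ## §1 The bootstrap form -/

section Boot

variable (AB : ℤ × ℤ)

/-- The identity form `4x³y + 4Axy³ + 4By⁴ = 4y(x³ + Axy² + By³)` (invariants `2⁴·(−3A)`, `2⁶·(−27B)`;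
this is the literal `⟨0, 4, 0, 4A, 4B⟩` that the tree calls the *identity quartic*:
`invariants_identityQuartic`, `isLocallySoluble_identityQuartic`, `map_identityQuartic`; Bhargava–Shankar
§2.4: the forms `q_{I,J}`). [cite: BhargavaShankarAnnals2015, §2.4 p. 12 (the forms q_{I,J}; arXiv:1006.1002v2 numbering)] -/
def identityForm : BinaryQuartic ℤ :=
  ⟨0, 4, 0, 4 * AB.1, 4 * AB.2⟩

/-- `I(identityForm) = 2⁴(−3A)`, `J(identityForm) = 2⁶(−27B)`. [cite: BhargavaShankarAnnals2015, §2.4 p. 12 (arXiv:1006.1002v2 numbering)] -/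
theorem invariants_identityForm :
    (identityForm AB).I = 2 ^ 4 * (-3 * AB.1) ∧ (identityForm AB).J = 2 ^ 6 * (-27 * AB.2) :=
  invariants_identityQuartic AB.1 AB.2

/-- `Δ(identityForm) = −2¹²(4A³ + 27B²)`. [folklore] -/
theorem disc_identityForm : (identityForm AB).disc = -(2 ^ 12 * (4 * AB.1 ^ 3 + 27 * AB.2 ^ 2)) := by
  simp only [identityForm, BinaryQuartic.disc]; ring

/-- **The bootstrap form** `f₀ = normRep(identityForm)`: a rational form with `a ≠ 0` in the
`E_{A,B}`-family with `t = 2`, `ℚ`-equivalent to the identity form. [folklore] -/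
def bootForm : BinaryQuartic ℚ :=
  normRep (identityForm AB)

/-- The rational root `r₀ = −1/k` of the bootstrap form (`k` the shear of `normRep`). [folklore] -/
def bootRoot : ℚ :=
  -1 / (normShift (identityForm AB) : ℚ)

variable {AB}

/-- The bootstrap form is in the `E_{A,B}`-family with `t = 2` (when `4A³ + 27B² ≠ 0`). [folklore] -/
theorem setup_bootForm (hE : 4 * AB.1 ^ 3 + 27 * AB.2 ^ 2 ≠ 0) :
    Setup (bootForm AB) (AB.1 : ℚ) (AB.2 : ℚ) 2 where
  a_ne := normRep_a_ne_zero _ (by rw [disc_identityForm]; exact neg_ne_zero.mpr (mul_ne_zero (by norm_num) hE))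
  t_ne := by norm_num
  I_eq := by rw [bootForm, I_normRep, (invariants_identityForm AB).1]; push_cast; ring
  J_eq := by rw [bootForm, J_normRep, (invariants_identityForm AB).2]; push_cast; ring
  disc_ne := by exact_mod_cast hE

/-- The shear of the bootstrap form is nonzero (the identity form has `a = 0`). [folklore] -/
theorem normShift_identityForm_ne_zero (hE : 4 * AB.1 ^ 3 + 27 * AB.2 ^ 2 ≠ 0) :
    normShift (identityForm AB) ≠ 0 := by
  intro h0
  have ha := (setup_bootForm hE).a_ne
  rw [bootForm, normRep, map_a, subst_shearMatrix_a, h0] at ha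
  simp [identityForm, BinaryQuartic.eval] at ha

/-- **The bootstrap form has the rational root `r₀`**: `f₀(r₀, 1) = 0`. [folklore] -/
theorem eval_bootRoot (hE : 4 * AB.1 ^ 3 + 27 * AB.2 ^ 2 ≠ 0) : (bootForm AB).eval (bootRoot AB) 1 = 0 := by
  have hk : (normShift (identityForm AB) : ℚ) ≠ 0 := by exact_mod_cast normShift_identityForm_ne_zero hE
  rw [bootForm, normRep, map_subst, eval_subst]
  have h2 : bootRoot AB * (shearMatrix (normShift (identityForm AB))).map (Int.castRingHom ℚ) 0 1 +
      1 * (shearMatrix (normShift (identityForm AB))).map (Int.castRingHom ℚ) 1 1 = 0 := by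
    simp [shearMatrix, bootRoot]
    field_simp
    ring
  rw [h2]
  simp [identityForm, BinaryQuartic.map, BinaryQuartic.eval]

end Boot

/-! ## §2 `E[2]` through the bootstrap form -/

section BootData

variable {AB : ℤ × ℤ} {Ω : Type*} [Field Ω] [Algebra ℚ Ω] [IsAlgClosed Ω]

/-- Root data of the bootstrap form over an algebraically closed `Ω`, ordered so that the root of
index `0` is the rational root `r₀`. [folklore] -/
def bootData (hE : 4 * AB.1 ^ 3 + 27 * AB.2 ^ 2 ≠ 0) :
    RootData ((bootForm AB).map (algebraMap ℚ Ω)) :=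
  let R := Classical.choice (RootData.nonempty (f := (bootForm AB).map (algebraMap ℚ Ω))
    ((setup_bootForm hE).map (algebraMap ℚ Ω)).a_ne)
  let i := Classical.choose (exists_eq_r R (setup_bootForm hE).a_ne (u := algebraMap ℚ Ω (bootRoot AB))
    (by rw [show (1 : Ω) = algebraMap ℚ Ω 1 from (map_one _).symm, eval_map, eval_bootRoot hE, map_zero]))
  R.reindex (Equiv.swap 0 i)

/-- The root of index `0` of the bootstrap data is the rational root `r₀`. [folklore] -/
theorem bootData_zero (hE : 4 * AB.1 ^ 3 + 27 * AB.2 ^ 2 ≠ 0) :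
    (bootData (Ω := Ω) hE).r 0 = algebraMap ℚ Ω (bootRoot AB) := by
  have h := Classical.choose_spec (exists_eq_r (Classical.choice (RootData.nonempty
    (f := (bootForm AB).map (algebraMap ℚ Ω)) ((setup_bootForm hE).map (algebraMap ℚ Ω)).a_ne))
    (setup_bootForm hE).a_ne (u := algebraMap ℚ Ω (bootRoot AB))
    (by rw [show (1 : Ω) = algebraMap ℚ Ω 1 from (map_one _).symm, eval_map, eval_bootRoot hE, map_zero]))
  rw [bootData]
  simp only [RootData.reindex_r, Equiv.swap_apply_left]
  exact h.symm

/-- A `ℚ`-automorphism fixes the rational root `r₀` of the bootstrap data. [folklore] -/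
theorem apply_bootData_zero (hE : 4 * AB.1 ^ 3 + 27 * AB.2 ^ 2 ≠ 0) (σ : Ω ≃ₐ[ℚ] Ω) :
    σ ((bootData (Ω := Ω) hE).r 0) = (bootData (Ω := Ω) hE).r 0 := by
  rw [bootData_zero, AlgEquiv.commutes]

end BootData

/-! ## §3 The Klein four-group on the indices and the sign characters -/

section Klein

/-- The Klein four-group law on `Fin 4` (`0` neutral, `k ⊕ k = 0`, `1 ⊕ 2 = 3`, …), matching
`T_k + T_l = T_{k ⊕ l}` for the torsor differences `T_k = T(r₀, r_k)`. [folklore] -/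
def v4add (k l : Fin 4) : Fin 4 :=
  if k = 0 then l else if l = 0 then k else if k = l then 0 else
    if k ≠ 1 ∧ l ≠ 1 then 1 else if k ≠ 2 ∧ l ≠ 2 then 2 else 3

/-- The **sign character** `sgn k i = e₂(T_k, T_i) ∈ {±1}`: `+1` iff `k = 0` or `k = i`
(for `i ∈ {1,2,3}`; the Weil pairing on `E[2]`, written on indices; `sgn k 0 = 1` by convention).
[folklore] -/
def sgn (k i : Fin 4) : ℤ :=
  if i = 0 ∨ k = 0 ∨ k = i then 1 else -1

/-- `sgn` is a character in the first variable: `sgn (k ⊕ l) i = sgn k i · sgn l i`. [folklore] -/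
theorem sgn_v4add (k l i : Fin 4) : sgn (v4add k l) i = sgn k i * sgn l i := by
  revert k l i; decide

/-- `sgn` is invariant under a permutation of the indices fixing `0` (Galois equivariance of the
Weil pairing). [folklore] -/
theorem sgn_perm (κ : Equiv.Perm (Fin 4)) (h0 : κ 0 = 0) (k i : Fin 4) : sgn (κ k) (κ i) = sgn k i := by
  unfold sgn
  have h1 : κ i = 0 ↔ i = 0 := ⟨fun h ↦ κ.injective (h.trans h0.symm), fun h ↦ h ▸ h0⟩
  have h2 : κ k = 0 ↔ k = 0 := ⟨fun h ↦ κ.injective (h.trans h0.symm), fun h ↦ h ▸ h0⟩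
  have h3 : κ k = κ i ↔ k = i := κ.injective.eq_iff
  simp only [h1, h2, h3]

/-- `v4add k l = 0 ↔ k = l`. [folklore] -/
theorem v4add_eq_zero_iff (k l : Fin 4) : v4add k l = 0 ↔ k = l := by revert k l; decide

/-- `sgn k i ∈ {1, −1}`. [folklore] -/
theorem sgn_sq (k i : Fin 4) : sgn k i * sgn k i = 1 := by
  unfold sgn; split_ifs <;> norm_num

/-- `v4add` is commutative. [folklore] -/
theorem v4add_comm (k l : Fin 4) : v4add k l = v4add l k := by revert k l; decide

/-- `v4add k 0 = k`. [folklore] -/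
theorem v4add_zero (k : Fin 4) : v4add k 0 = k := by revert k; decide

/-- `v4add 0 k = k`. [folklore] -/
theorem zero_v4add (k : Fin 4) : v4add 0 k = k := by revert k; decide

/-- `v4add k k = 0`. [folklore] -/
theorem v4add_self (k : Fin 4) : v4add k k = 0 := by revert k; decide

/-- For distinct nonzero `k, l`, `k ⊕ l` is the remaining nonzero index. [folklore] -/
theorem v4add_ne {k l : Fin 4} (hk : k ≠ 0) (hl : l ≠ 0) (hkl : k ≠ l) :
    v4add k l ≠ 0 ∧ v4add k l ≠ k ∧ v4add k l ≠ l := by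
  revert k l; decide

/-- A sign vector determines the index: if `sgn k i = sgn l i` for `i = 1, 2, 3` then `k = l`.
[folklore] -/
theorem eq_of_sgn_eq {k l : Fin 4} (h1 : sgn k 1 = sgn l 1) (h2 : sgn k 2 = sgn l 2) (h3 : sgn k 3 = sgn l 3) :
    k = l := by
  revert k l; decide

variable {F : Type*} [Field F] {C : Affine F} {A B t : F} {f : BinaryQuartic F}
  (R : RootData f) (hC : IsShortModel C A B)

omit [Field F] in
/-- Congruence for the total function `torsorPt`: equal torsion abscissae and equal (in)equality of the
arguments give equal torsor differences. [folklore] -/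
theorem torsorPt_congr' {F : Type*} [Field F] {C : Affine F} (f : BinaryQuartic F) (t : F) {u v u' v' : F}
    (hx : torsX f t u v = torsX f t u' v') (hne : u ≠ v ↔ u' ≠ v') :
    torsorPt C f t u v = torsorPt C f t u' v' := by
  by_cases h : u ≠ v ∧ C.Nonsingular (torsX f t u v) 0
  · have h' : u' ≠ v' ∧ C.Nonsingular (torsX f t u' v') 0 := ⟨hne.mp h.1, hx ▸ h.2⟩
    rw [torsorPt, dif_pos h, torsorPt, dif_pos h']
    simp only [Point.some.injEq, and_true]
    exact hx
  · have h' : ¬(u' ≠ v' ∧ C.Nonsingular (torsX f t u' v') 0) := fun h' ↦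
      h ⟨hne.mpr h'.1, hx.symm ▸ h'.2⟩
    rw [torsorPt, dif_neg h, torsorPt, dif_neg h']

include hC

/-- **`T(r₀, r_k) + T(r₀, r_l) = T(r₀, r_{k ⊕ l})`**: the torsor differences from `r₀` form a Klein
four-group (Chasles, symmetry and `T(r₁, r₂) = T(r₀, r₃)` for complementary pairs). [folklore] -/
theorem torsorPt_v4add (ha : f.a ≠ 0) (h3 : (3 : F) ≠ 0) (hΔ : f.disc ≠ 0) (ht : t ≠ 0)
    (hI : f.I = -3 * A * t ^ 4) (hJ : f.J = -27 * B * t ^ 6) (k l : Fin 4) :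
    torsorPt C f t (R.r 0) (R.r k) + torsorPt C f t (R.r 0) (R.r l) = torsorPt C f t (R.r 0) (R.r (v4add k l)) := by
  have chasles := fun i j k ↦ torsorPt_add_torsorPt hC R ha h3 hΔ ht hI hJ i j k
  -- complementary pairs have the same torsion abscissa
  have hcomp : ∀ {i j k l : Fin 4}, i ≠ j → k ≠ l → i ≠ k → i ≠ l → j ≠ k → j ≠ l →
      torsorPt C f t (R.r i) (R.r j) = torsorPt C f t (R.r k) (R.r l) := by
    intro i j k l hij hkl hik hil hjk hjl
    obtain ⟨σ, h0, h1, h2⟩ := exists_perm_fin_four hij hjk hik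
    have h3' : σ 3 = l := by
      have hinj := σ.injective
      have : ∀ m : Fin 4, σ m = l → m = 3 := by
        intro m hm
        fin_cases m
        · exact absurd (h0.symm.trans hm) hil
        · exact absurd (h1.symm.trans hm) hjl
        · exact absurd (h2.symm.trans hm) hkl
        · rfl
      obtain ⟨m, hm⟩ := σ.surjective l
      rw [← this m hm, hm]
    have key := (R.reindex σ).phi12_eq_phi03
    simp only [RootData.reindex_r, h0, h1, h2, h3'] at key
    -- `T(j, k) = T(i, l)`; we want `T(i, j) = T(k, l)`: use the `(0,2)` complementary identity instead
    have key2 := phi_compl_ofRoots f.a (R.reindex σ).r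
    rw [← (R.reindex σ).eq_ofRoots] at key2
    simp only [RootData.reindex_r, h0, h1, h2, h3'] at key2
    -- key2 : φ(k, l) = φ(i, j)
    have hne1 : R.r i ≠ R.r j := fun h ↦ hij (R.injective hΔ h)
    have hne2 : R.r k ≠ R.r l := fun h ↦ hkl (R.injective hΔ h)
    refine torsorPt_congr' f t ?_ ⟨fun _ ↦ hne2, fun _ ↦ hne1⟩
    rw [torsX, torsX, key2]
  by_cases hk : k = 0
  · subst hk; rw [torsorPt_self, zero_add, zero_v4add]
  by_cases hl : l = 0
  · subst hl; rw [torsorPt_self, add_zero, v4add_zero]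
  by_cases hkl : k = l
  · subst hkl; rw [torsorPt_add_self hC, v4add_self, torsorPt_self]
  -- `k, l` distinct nonzero: `T(0,k) + T(0,l) = T(k, l) = T(0, m)` with `m` the fourth index
  have e1 : torsorPt C f t (R.r 0) (R.r k) + torsorPt C f t (R.r 0) (R.r l) = torsorPt C f t (R.r k) (R.r l) := by
    rw [torsorPt_comm f t (R.r 0) (R.r k)]; exact chasles k 0 l
  rw [e1]
  have hm := v4add_ne hk hl hkl
  exact hcomp hkl (Ne.symm hm.1) hk (Ne.symm hm.2.1) hl (Ne.symm hm.2.2)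

end Klein

/-! ## §4 Translation by a `2`-torsion point and the functions `gₑ` -/

section GFun

variable {F : Type*} [Field F]

/-- The Möbius action of translation by the `2`-torsion point `(e, 0)` on `x`-coordinates:
`x(P + T) = (ex + 2e² + A)/(x − e)`. A total function, meaningful for `x ≠ e` (junk value `0` at
`x = e`, by `x / 0 = 0`). [folklore] -/
def mobT (A e x : F) : F := (e * x + 2 * e ^ 2 + A) / (x - e)

/-- The `y`-coordinate after translation by `(e, 0)`: `y(P + T) = −(3e² + A)y/(x − e)²`. Meaningful
for `x ≠ e` (junk value `0` at `x = e`). [folklore] -/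
def mobTY (A e x y : F) : F := -(3 * e ^ 2 + A) * y / (x - e) ^ 2

/-- **The `2`-descent functions** `gₑ(x, y) = ((x − e)² − (3e² + A))/(2y)` (so that
`x(2P) − e = gₑ(P)²`: Cremona 2001 §5 / the classical `x − e ≡ □` descent; here `3e² + A =
(e − e′)(e − e″)`). Meaningful for `y ≠ 0` (junk value `0` at `y = 0`); the theorems carry the
hypothesis. [cite: Cremona2001, §5 (2-descent via the cubic field, z = (4aφ + p)/3)] -/
def gfun (A e x y : F) : F := ((x - e) ^ 2 - (3 * e ^ 2 + A)) / (2 * y)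

/-- `M_T(x) − e = (3e² + A)/(x − e)`. [folklore] -/
theorem mobT_sub_self (A e x : F) (hx : x - e ≠ 0) : mobT A e x - e = (3 * e ^ 2 + A) / (x - e) := by
  rw [mobT, div_sub' hx]; congr 1; ring

/-- `M_{T′}(x) − e = (e′ − e)(x + e + e′)/(x − e′)` for another root `e′` (`A = −(e² + ee′ + e′²)`).
[folklore] -/
theorem mobT_sub_other {A e e' x : F} (hx : x - e' ≠ 0) (hA : A = -(e ^ 2 + e * e' + e' ^ 2)) :
    mobT A e' x - e = (e' - e) * (x + e + e') / (x - e') := by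
  rw [mobT, div_sub' hx, hA]; congr 1; ring

/-- `gₑ` is invariant under translation by `(e, 0)` itself: `gₑ(P + T) = gₑ(P)` (exact identity in
the coordinates). [folklore] -/
theorem gfun_mobT_self {A e x y : F} (h2 : (2 : F) ≠ 0) (hy : y ≠ 0) (hx : x - e ≠ 0)
    (hF' : 3 * e ^ 2 + A ≠ 0) :
    gfun A e (mobT A e x) (mobTY A e x y) = gfun A e x y := by
  have hx2 : (x - e) ^ 2 ≠ 0 := pow_ne_zero _ hx
  rw [gfun, gfun, mobT_sub_self A e x hx, mobTY]
  have e2 : ((3 * e ^ 2 + A) / (x - e)) ^ 2 - (3 * e ^ 2 + A) =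
      (-(3 * e ^ 2 + A) * ((x - e) ^ 2 - (3 * e ^ 2 + A))) / (x - e) ^ 2 := by
    rw [div_pow, div_sub' hx2]; congr 1; ring
  have e3 : 2 * (-(3 * e ^ 2 + A) * y / (x - e) ^ 2) = (-(2 * (3 * e ^ 2 + A) * y)) / (x - e) ^ 2 := by ring
  rw [e2, e3, div_div_div_cancel_right₀ hx2, div_eq_div_iff (neg_ne_zero.mpr (mul_ne_zero (mul_ne_zero h2 hF') hy))
    (mul_ne_zero h2 hy)]
  ring

/-- `gₑ` changes sign under translation by another `2`-torsion point `(e′, 0)`: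
`gₑ(P + T′) = −gₑ(P)` (exact identity, using `A = −(e² + ee′ + e′²)`, i.e. `e, e′, −e−e′` are the
roots). This is the Weil pairing `e₂(T, T′) = −1`. [folklore] -/
theorem gfun_mobT_other {A e e' x y : F} (h2 : (2 : F) ≠ 0) (hy : y ≠ 0) (hx : x - e' ≠ 0)
    (hee : e - e' ≠ 0) (hee' : 2 * e' + e ≠ 0) (hA : A = -(e ^ 2 + e * e' + e' ^ 2)) :
    gfun A e (mobT A e' x) (mobTY A e' x y) = -gfun A e x y := by
  have hx2 : (x - e') ^ 2 ≠ 0 := pow_ne_zero _ hx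
  rw [gfun, gfun, mobT_sub_other hx hA, mobTY]
  have hF1 : 3 * e ^ 2 + A = (e - e') * (2 * e + e') := by rw [hA]; ring
  have hF2 : 3 * e' ^ 2 + A = -((e - e') * (2 * e' + e)) := by rw [hA]; ring
  rw [hF1, hF2]
  have e2 : ((e' - e) * (x + e + e') / (x - e')) ^ 2 - (e - e') * (2 * e + e') =
      ((e - e') * ((e - e') * (x + e + e') ^ 2 - (2 * e + e') * (x - e') ^ 2)) / (x - e') ^ 2 := by
    rw [div_pow, div_sub' hx2]; congr 1; ring
  have e3 : 2 * (-(-((e - e') * (2 * e' + e))) * y / (x - e') ^ 2) =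
      (2 * (e - e') * (2 * e' + e) * y) / (x - e') ^ 2 := by ring
  rw [e2, e3, div_div_div_cancel_right₀ hx2, neg_div', div_eq_div_iff
    (mul_ne_zero (mul_ne_zero (mul_ne_zero h2 hee) hee') hy) (mul_ne_zero h2 hy)]
  ring

/-- **`gₑ(P)² = x(2P) − e`**: with `x(2P) = ((3x² + A)/(2y))² − 2x` on `y² = x³ + Ax + B` and
`e³ + Ae + B = 0`. [cite: Cremona2001, §5 (z ≡ x − e modulo squares)] -/
theorem gfun_sq {A B e x y : F} (h2 : (2 : F) ≠ 0) (hy0 : y ≠ 0) (hy : y ^ 2 = x ^ 3 + A * x + B)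
    (he : e ^ 3 + A * e + B = 0) :
    gfun A e x y ^ 2 = ((3 * x ^ 2 + A) / (2 * y)) ^ 2 - 2 * x - e := by
  have h2y : (2 * y) ^ 2 ≠ 0 := pow_ne_zero _ (mul_ne_zero h2 hy0)
  rw [gfun, div_pow, div_pow, eq_sub_iff_add_eq, eq_sub_iff_add_eq, div_add' _ _ _ h2y, div_add' _ _ _ h2y,
    div_left_inj' h2y]
  linear_combination (4 * (e + 2 * x)) * hy + (4 * (e + 2 * x)) * he

variable {C : Affine F} {A B : F} (hC : IsShortModel C A B)
include hC

/-- **Doubling in coordinates** on the short model: for `y ≠ 0`, `x(P + P) = ((3x² + A)/(2y))² − 2x`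
(as the `x`-coordinate of Mathlib's sum). [folklore] -/
theorem addX_self {x y : F} (h2 : (2 : F) ≠ 0) (hy : y ≠ 0) :
    C.addX x x (C.slope x x y y) = ((3 * x ^ 2 + A) / (2 * y)) ^ 2 - 2 * x := by
  have hne : y ≠ C.negY x y := by
    rw [hC.negY]; intro h
    exact hy ((mul_eq_zero.mp (show 2 * y = 0 by linear_combination h)).resolve_left h2)
  have hsl : C.slope x x y y = (3 * x ^ 2 + A) / (2 * y) := by
    rw [Affine.slope_of_Y_ne rfl hne, hC.a₁, hC.a₂, hC.a₄, hC.negY]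
    congr 1 <;> ring
  rw [Affine.addX, hsl, hC.a₁, hC.a₂]
  ring

/-- **Translation by `(e, 0)` in coordinates, `x`**: `x((x, y) + (e, 0)) = mobT A e x`. [folklore] -/
theorem addX_torsion {x y e : F} (hxy : C.Nonsingular x y) (he : C.Nonsingular e 0) (hxe : x ≠ e) :
    C.addX x e (C.slope x e y 0) = mobT A e x := by
  have hcub : e ^ 3 + A * e + B = 0 := ((hC.nonsingular_zero_iff e).mp he).1
  have hy : y ^ 2 = x ^ 3 + A * x + B := (hC.equation_iff x y).mp hxy.1
  have hx : x - e ≠ 0 := sub_ne_zero.mpr hxe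
  have hx2 : (x - e) ^ 2 ≠ 0 := pow_ne_zero _ hx
  rw [Affine.addX, Affine.slope_of_X_ne hxe, hC.a₁, hC.a₂, mobT, sub_zero, div_pow, zero_mul, add_zero, sub_zero,
    div_sub' hx2, div_sub' hx2, div_eq_div_iff hx2 hx]
  linear_combination (x - e) * hy + (x - e) * hcub

/-- **Translation by `(e, 0)` in coordinates, `y`**: `y((x, y) + (e, 0)) = mobTY A e x y`. [folklore] -/
theorem addY_torsion {x y e : F} (hxy : C.Nonsingular x y) (he : C.Nonsingular e 0) (hxe : x ≠ e) :
    C.addY x e y (C.slope x e y 0) = mobTY A e x y := by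
  have hx : x - e ≠ 0 := sub_ne_zero.mpr hxe
  have hx2 : (x - e) ^ 2 ≠ 0 := pow_ne_zero _ hx
  rw [Affine.addY, Affine.negAddY, addX_torsion hC hxy he hxe, hC.negY, Affine.slope_of_X_ne hxe, mobT,
    mobTY, sub_zero, div_sub' hx, div_mul_div_comm, div_add' _ _ _ (mul_ne_zero hx hx), neg_div',
    div_eq_div_iff (mul_ne_zero hx hx) hx2]
  ring

/-- **Translation by `(e, 0)` on points**: `(x, y) + (e, 0) = (mobT A e x, mobTY A e x y)`, `x ≠ e`.
[folklore] -/
theorem some_add_torsion {x y e : F} (hxy : C.Nonsingular x y) (he : C.Nonsingular e 0) (hxe : x ≠ e) :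
    ∃ h, Point.some x y hxy + Point.some e 0 he = Point.some (mobT A e x) (mobTY A e x y) h := by
  refine ⟨?_, ?_⟩
  · rw [← addX_torsion hC hxy he hxe, ← addY_torsion hC hxy he hxe]
    exact Affine.nonsingular_add hxy he fun h ↦ hxe h.1
  · rw [Point.add_of_X_ne hxe]
    simp only [Point.some.injEq]
    exact ⟨addX_torsion hC hxy he hxe, addY_torsion hC hxy he hxe⟩

/-- **Doubling on points**: for `P = (x, y)` with `y ≠ 0`, `x(P + P) = ((3x² + A)/(2y))² − 2x`.
[folklore] -/
theorem some_add_self {x y : F} (hxy : C.Nonsingular x y) (h2 : (2 : F) ≠ 0) (hy : y ≠ 0) :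
    ∃ y' h, Point.some x y hxy + Point.some x y hxy =
      Point.some (((3 * x ^ 2 + A) / (2 * y)) ^ 2 - 2 * x) y' h := by
  have hne : y ≠ C.negY x y := by
    rw [hC.negY]; intro h
    exact hy ((mul_eq_zero.mp (show 2 * y = 0 by linear_combination h)).resolve_left h2)
  refine ⟨C.addY x x y (C.slope x x y y), ?_, ?_⟩
  · rw [← addX_self hC h2 hy]
    exact Affine.nonsingular_add hxy hxy fun h ↦ hne h.2
  · rw [Point.add_self_of_Y_ne hne]
    simp only [Point.some.injEq, and_true]
    exact addX_self hC h2 hy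

end GFun

/-! ## §5 The twisted fixed point -/

section FixedPoint

variable {F : Type*} [Field F]

/-- **The twisted fixed point identity.** If `zᵢ² = α + βeᵢ` for the three roots `eᵢ` of
`X³ + AX + B` (`e₁ + e₂ + e₃ = 0`, `e₁e₂ + e₁e₃ + e₂e₃ = A`) and `β ≠ 0`, then with
`x′ = −α/β − (z₁z₂ + z₁z₃ + z₂z₃)/β` and `x″` the same with the signs of `z₂, z₃` changed,
`x″(x′ − e₁) = e₁x′ + 2e₁² + A`, i.e. `x″ = M_{T₁}(x′)` when `x′ ≠ e₁`: the point `x′ = x(R′)` of the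
`ℙ¹` twisted by the cocycle of Möbius maps `M_{T}` is fixed (`R′` a half of the rational point
`(−α/β, ·)`). (For `β = 0` the statement would be about junk values of division and is not
claimed.) [folklore] -/
theorem twistedFixedPoint_identity {z₁ z₂ z₃ α β e₁ e₂ e₃ A : F} (hz₁ : z₁ ^ 2 = α + β * e₁)
    (hz₂ : z₂ ^ 2 = α + β * e₂) (hz₃ : z₃ ^ 2 = α + β * e₃) (hs : e₁ + e₂ + e₃ = 0)
    (hA : A = e₁ * e₂ + e₁ * e₃ + e₂ * e₃) (hβ : β ≠ 0) :
    (-α / β - (-(z₁ * z₂) - z₁ * z₃ + z₂ * z₃) / β) * (-α / β - (z₁ * z₂ + z₁ * z₃ + z₂ * z₃) / β - e₁) -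
      (e₁ * (-α / β - (z₁ * z₂ + z₁ * z₃ + z₂ * z₃) / β) + 2 * e₁ ^ 2 + A) = 0 := by
  have key : ((-α - (-(z₁ * z₂) - z₁ * z₃ + z₂ * z₃)) * (-α - (z₁ * z₂ + z₁ * z₃ + z₂ * z₃) - β * e₁) -
      β * (e₁ * (-α - (z₁ * z₂ + z₁ * z₃ + z₂ * z₃)) + (2 * e₁ ^ 2 + A) * β)) = 0 := by
    linear_combination (-(z₂ + z₃) ^ 2) * hz₁ + (-α - β * e₁ + z₃ ^ 2) * hz₂ + (-(β * (e₁ - e₂))) * hz₃ +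
      (-β ^ 2) * hA + (-(2 * β ^ 2 * e₁)) * hs
  have : β ^ 2 * ((-α / β - (-(z₁ * z₂) - z₁ * z₃ + z₂ * z₃) / β) * (-α / β - (z₁ * z₂ + z₁ * z₃ + z₂ * z₃) / β - e₁) -
      (e₁ * (-α / β - (z₁ * z₂ + z₁ * z₃ + z₂ * z₃) / β) + 2 * e₁ ^ 2 + A)) =
      ((-α - (-(z₁ * z₂) - z₁ * z₃ + z₂ * z₃)) * (-α - (z₁ * z₂ + z₁ * z₃ + z₂ * z₃) - β * e₁) -
      β * (e₁ * (-α - (z₁ * z₂ + z₁ * z₃ + z₂ * z₃)) + (2 * e₁ ^ 2 + A) * β)) := by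
    field_simp
    ring
  rw [key] at this
  exact (mul_eq_zero.mp this).resolve_left (pow_ne_zero _ hβ)

/-- **The twisted fixed point**, division form: under the hypotheses of
`twistedFixedPoint_identity` with `β ≠ 0` and `x′ ≠ e₁`,
`x″ = (e₁x′ + 2e₁² + A)/(x′ − e₁) = mobT A e₁ x′`. [folklore] -/
theorem twistedFixedPoint {z₁ z₂ z₃ α β e₁ e₂ e₃ A : F} (hz₁ : z₁ ^ 2 = α + β * e₁)
    (hz₂ : z₂ ^ 2 = α + β * e₂) (hz₃ : z₃ ^ 2 = α + β * e₃) (hs : e₁ + e₂ + e₃ = 0)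
    (hA : A = e₁ * e₂ + e₁ * e₃ + e₂ * e₃) (hβ : β ≠ 0)
    (hx : -α / β - (z₁ * z₂ + z₁ * z₃ + z₂ * z₃) / β - e₁ ≠ 0) :
    -α / β - (-(z₁ * z₂) - z₁ * z₃ + z₂ * z₃) / β = mobT A e₁ (-α / β - (z₁ * z₂ + z₁ * z₃ + z₂ * z₃) / β) := by
  have h' := twistedFixedPoint_identity hz₁ hz₂ hz₃ hs hA hβ
  rw [mobT, eq_div_iff hx]
  linear_combination h'

end FixedPoint

/-! ## §6 Vieta relations for the torsion abscissae -/

section Vieta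

variable {F : Type*} [Field F] {A B t : F} {f : BinaryQuartic F} (R : RootData f)

/-- **Vieta for the torsion abscissae** `e_k = x(r₀, r_k)`: `e₁ + e₂ + e₃ = 0`,
`e₁e₂ + e₁e₃ + e₂e₃ = A`, `e₁e₂e₃ = −B` (from the resolvent relations for `φ₀ₖ`). [folklore] -/
theorem torsX_vieta (h3 : (3 : F) ≠ 0) (ht : t ≠ 0) (hI : f.I = -3 * A * t ^ 4) (hJ : f.J = -27 * B * t ^ 6) :
    torsX f t (R.r 0) (R.r 1) + torsX f t (R.r 0) (R.r 2) + torsX f t (R.r 0) (R.r 3) = 0 ∧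
    torsX f t (R.r 0) (R.r 1) * torsX f t (R.r 0) (R.r 2) + torsX f t (R.r 0) (R.r 1) * torsX f t (R.r 0) (R.r 3) +
      torsX f t (R.r 0) (R.r 2) * torsX f t (R.r 0) (R.r 3) = A ∧
    torsX f t (R.r 0) (R.r 1) * torsX f t (R.r 0) (R.r 2) * torsX f t (R.r 0) (R.r 3) = -B := by
  have ht2 : (3 : F) * t ^ 2 ≠ 0 := mul_ne_zero h3 (pow_ne_zero _ ht)
  have h27 : (27 : F) ≠ 0 := twentySeven_ne_zero h3
  have hsum := phi_sum_ofRoots f.a R.r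
  have hsum2 := phi_sum_mul_ofRoots f.a R.r
  have hprod := (resolvent_eq_ofRoots f.a R.r)
  rw [← R.eq_ofRoots] at hsum hsum2 hprod
  -- constant term of the resolvent identity: `−φ₁φ₂φ₃ = J`, i.e. evaluate at `X = 0`
  have hprod0 := hprod 0
  have hA : A = -f.I / (3 * t ^ 4) := by rw [hI]; field_simp
  have hB : B = -f.J / (27 * t ^ 6) := by rw [hJ]; field_simp
  refine ⟨?_, ?_, ?_⟩
  · have : torsX f t (R.r 0) (R.r 1) + torsX f t (R.r 0) (R.r 2) + torsX f t (R.r 0) (R.r 3) =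
        -(phi f (R.r 0) (R.r 1) + phi f (R.r 0) (R.r 2) + phi f (R.r 0) (R.r 3)) / (3 * t ^ 2) := by
      simp only [torsX]; ring
    rw [this, hsum, neg_zero, zero_div]
  · have : torsX f t (R.r 0) (R.r 1) * torsX f t (R.r 0) (R.r 2) + torsX f t (R.r 0) (R.r 1) * torsX f t (R.r 0) (R.r 3) +
        torsX f t (R.r 0) (R.r 2) * torsX f t (R.r 0) (R.r 3) = (phi f (R.r 0) (R.r 1) * phi f (R.r 0) (R.r 2) +
        phi f (R.r 0) (R.r 1) * phi f (R.r 0) (R.r 3) + phi f (R.r 0) (R.r 2) * phi f (R.r 0) (R.r 3)) /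
        (3 * t ^ 2) ^ 2 := by
      simp only [torsX]
      field_simp
    rw [this, hsum2, hA]
    field_simp
    try ring
  · have : torsX f t (R.r 0) (R.r 1) * torsX f t (R.r 0) (R.r 2) * torsX f t (R.r 0) (R.r 3) =
        -(phi f (R.r 0) (R.r 1) * phi f (R.r 0) (R.r 2) * phi f (R.r 0) (R.r 3)) / (3 * t ^ 2) ^ 3 := by
      simp only [torsX]
      field_simp
    have hprod' : phi f (R.r 0) (R.r 1) * phi f (R.r 0) (R.r 2) * phi f (R.r 0) (R.r 3) = -f.J := by
      linear_combination -hprod0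
    rw [this, hprod', hB]
    field_simp
    try ring

/-- `3e_i² + A = (e_i − e_j)(e_i − e_k)` for the three torsion abscissae (`{i,j,k} = {1,2,3}`), in the
form needed for `gfun`: with `e₃ = −e₁ − e₂`, `A = −(e₁² + e₁e₂ + e₂²)`. [folklore] -/
theorem A_eq_of_vieta {e₁ e₂ e₃ A : F} (hs : e₁ + e₂ + e₃ = 0) (hA : e₁ * e₂ + e₁ * e₃ + e₂ * e₃ = A) :
    A = -(e₁ ^ 2 + e₁ * e₂ + e₂ ^ 2) := by
  have h3 : e₃ = -e₁ - e₂ := by linear_combination hs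
  rw [← hA, h3]; ring

end Vieta

end TwoCovering

end Literature.NumberTheory.EllipticCurves
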